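import Literature.AlgebraicGeometry.Motives.MixedHodgeExtensionTensorClass
import Literature.AlgebraicGeometry.Motives.MixedHodgeExtensionNonSeparatedGroup
import HarnessLib

/-!
# The class of `C ⊗ E`: left tensoring of extensions through the symmetry `E ⊗ C ≅ C ⊗ E`

Jannsen, *Mixed Motives and Algebraic K-Theory* (LNM 1400), §9 Remark 9.3 a) tensors extensions of
mixed Hodge structures with a fixed mixed Hodge structure; Deligne, *Hodge II*, 1.1.12: the tensor
product of (bi)filtered objects is a symmetric functorial construction. The tree has both
`E ⊗ C = Extension.rTensor E C` and `C ⊗ E = Extension.lTensor C E` (`MixedHodgeExtensionTensor`),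
the class formula `[E ⊗ C]_W = [E]_W ⊗ 1` (`MixedHodgeExtensionTensorClass`) and the symmetry
isomorphism of MHS `tensorComm H₁ H₂ : H₁ ⊗ H₂ → H₂ ⊗ H₁` (`MixedHodgeStructureTensorMorphisms`).
This file derives the left-handed calculus from the right-handed one through the symmetry:

* §1 the morphism of extensions **`(σ_B, σ_E, σ_A) : E ⊗ C → C ⊗ E`** (`Extension.rTensorToLTensor`)
  and its inverse, all components isomorphisms; the symmetry commutes with `g ⊗ 1 ↦ 1 ⊗ g`.
* §2 **`clsW_lTensor_eq : [C ⊗ E]_W = (σ_{C,A})^* (σ_{B,C})_* ([E]_W ⊗ 1)`** (Mac Lane III Prop. 1.8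
  along the symmetry morphism, then `clsW_rTensor`); the map
  **`JHomW.lTensor C : J⁰W₀Hom(A, B) → J⁰W₀Hom(C ⊗ A, C ⊗ B)`, `[φ] ↦ [σ_ℂ ∘ (φ ⊗ 1) ∘ σ_ℂ] = [1 ⊗ φ]`**,
  and **`clsW_lTensor : [C ⊗ E]_W = JHomW.lTensor C [E]_W`**; split iff.
* §3 **`Ext.lTensorMap C : Ext(A, B) → Ext(C ⊗ A, C ⊗ B)`**, `x ↦ (σ_{C,A})^* (σ_{B,C})_* (x ⊗ C)`, with
  `lTensorMap_mkOfW : lTensorMap C [E] = [C ⊗ E]`, additivity, and the symmetry square with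
  `rTensorMap`; congruent extensions have congruent left tensor products.

All statements proved; no named facts.

## References

* [Jannsen1990MixedMotives] U. Jannsen, Mixed Motives and Algebraic K-Theory, LNM 1400 (1990), §9
  Remark 9.3 a) (store `book:jannsennd-mixed-motives-algebraic-k-theory`, chunk p0100).
* [DeligneHodgeII1971] P. Deligne, Théorie de Hodge II, 1.1.12.
* [MacLane1963Homology] S. Mac Lane, Homology (1963), Ch. III §1 Prop. 1.8, Lemmas 1.2, 1.4.
* [BrylinskiZucker1998] J.-L. Brylinski, S. Zucker, An overview of recent advances in Hodge theory,
  Prop. 5.22.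
-/

open scoped TensorProduct

noncomputable section

namespace Literature.AlgebraicGeometry.Motives

namespace MixedHodgeStructure

universe u v w w' x u' v'

variable {VA : Type u} [AddCommGroup VA] [Module ℚ VA] [FiniteDimensional ℚ VA]
variable {VB : Type v} [AddCommGroup VB] [Module ℚ VB] [FiniteDimensional ℚ VB]
variable {VA' : Type u'} [AddCommGroup VA'] [Module ℚ VA'] [FiniteDimensional ℚ VA']
variable {VB' : Type v'} [AddCommGroup VB'] [Module ℚ VB'] [FiniteDimensional ℚ VB']
variable {VE : Type w} [AddCommGroup VE] [Module ℚ VE] [FiniteDimensional ℚ VE]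
variable {VE' : Type w'} [AddCommGroup VE'] [Module ℚ VE'] [FiniteDimensional ℚ VE']
variable {VC : Type x} [AddCommGroup VC] [Module ℚ VC] [FiniteDimensional ℚ VC]

/-! ### §1 The symmetry morphism of extensions `E ⊗ C → C ⊗ E` -/

section Symmetry

variable {A : MixedHodgeStructure VA} {B : MixedHodgeStructure VB}
variable {A' : MixedHodgeStructure VA'} {B' : MixedHodgeStructure VB'}

/-- **The symmetry is natural**: `σ_{B',C} ∘ (g ⊗ 1) = (1 ⊗ g) ∘ σ_{B,C}` for a morphism `g : B → B'`
(Deligne, Hodge II, 1.1.12: `⊗` is a symmetric functorial construction). [cite: DeligneHodgeII1971, 1.1.12] -/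
theorem tensorComm_comp_tensorMap_id {B : MixedHodgeStructure VB} {B' : MixedHodgeStructure VB'}
    (g : Hom B B') (C : MixedHodgeStructure VC) :
    (tensorComm B' C).comp (g.tensorMap (Hom.id C)) = ((Hom.id C).tensorMap g).comp (tensorComm B C) :=
  Hom.ext (TensorProduct.ext' fun _ _ => rfl)

/-- `σ_{C,B'} ∘ (1 ⊗ g) = (g ⊗ 1) ∘ σ_{C,B}`. [cite: DeligneHodgeII1971, 1.1.12] -/
theorem tensorComm_comp_id_tensorMap {B : MixedHodgeStructure VB} {B' : MixedHodgeStructure VB'}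
    (g : Hom B B') (C : MixedHodgeStructure VC) :
    (tensorComm C B').comp ((Hom.id C).tensorMap g) = (g.tensorMap (Hom.id C)).comp (tensorComm C B) :=
  Hom.ext (TensorProduct.ext' fun _ _ => rfl)

namespace Extension

variable (E : Extension A B VE) (C : MixedHodgeStructure VC)

omit [FiniteDimensional ℚ VA'] [FiniteDimensional ℚ VB'] [FiniteDimensional ℚ VE'] [AddCommGroup VA']
  [Module ℚ VA'] [AddCommGroup VB'] [Module ℚ VB'] [AddCommGroup VE'] [Module ℚ VE'] in
/-- **The symmetry morphism of extensions `(σ_B, σ_E, σ_A) : E ⊗ C → C ⊗ E`**, all three components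
the symmetry isomorphisms `v ⊗ w ↦ w ⊗ v` of MHS. [cite: DeligneHodgeII1971, 1.1.12]
[cite: MacLane1963Homology, Ch. III Prop. 1.8] -/
def rTensorToLTensor : Morphism (E.rTensor C) (E.lTensor C) where
  left := tensorComm B C
  mid := tensorComm E.mhs C
  right := tensorComm A C
  mid_inc := TensorProduct.ext' fun _ _ => rfl
  proj_mid := TensorProduct.ext' fun _ _ => rfl

omit [FiniteDimensional ℚ VA'] [FiniteDimensional ℚ VB'] [FiniteDimensional ℚ VE'] [AddCommGroup VA']
  [Module ℚ VA'] [AddCommGroup VB'] [Module ℚ VB'] [AddCommGroup VE'] [Module ℚ VE'] in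
/-- The components of the symmetry morphism (by `rfl`). [cite: DeligneHodgeII1971, 1.1.12] -/
@[simp]
theorem rTensorToLTensor_left : (E.rTensorToLTensor C).left = tensorComm B C := rfl

omit [FiniteDimensional ℚ VA'] [FiniteDimensional ℚ VB'] [FiniteDimensional ℚ VE'] [AddCommGroup VA']
  [Module ℚ VA'] [AddCommGroup VB'] [Module ℚ VB'] [AddCommGroup VE'] [Module ℚ VE'] in
/-- The components of the symmetry morphism (by `rfl`). [cite: DeligneHodgeII1971, 1.1.12] -/
@[simp]
theorem rTensorToLTensor_mid : (E.rTensorToLTensor C).mid = tensorComm E.mhs C := rfl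

omit [FiniteDimensional ℚ VA'] [FiniteDimensional ℚ VB'] [FiniteDimensional ℚ VE'] [AddCommGroup VA']
  [Module ℚ VA'] [AddCommGroup VB'] [Module ℚ VB'] [AddCommGroup VE'] [Module ℚ VE'] in
/-- The components of the symmetry morphism (by `rfl`). [cite: DeligneHodgeII1971, 1.1.12] -/
@[simp]
theorem rTensorToLTensor_right : (E.rTensorToLTensor C).right = tensorComm A C := rfl

omit [FiniteDimensional ℚ VA'] [FiniteDimensional ℚ VB'] [FiniteDimensional ℚ VE'] [AddCommGroup VA']
  [Module ℚ VA'] [AddCommGroup VB'] [Module ℚ VB'] [AddCommGroup VE'] [Module ℚ VE'] in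
/-- **The inverse symmetry morphism `(σ, σ, σ) : C ⊗ E → E ⊗ C`.** [cite: DeligneHodgeII1971, 1.1.12]
[cite: MacLane1963Homology, Ch. III Prop. 1.8] -/
def lTensorToRTensor : Morphism (E.lTensor C) (E.rTensor C) where
  left := tensorComm C B
  mid := tensorComm C E.mhs
  right := tensorComm C A
  mid_inc := TensorProduct.ext' fun _ _ => rfl
  proj_mid := TensorProduct.ext' fun _ _ => rfl

omit [FiniteDimensional ℚ VA'] [FiniteDimensional ℚ VB'] [FiniteDimensional ℚ VE'] [AddCommGroup VA']
  [Module ℚ VA'] [AddCommGroup VB'] [Module ℚ VB'] [AddCommGroup VE'] [Module ℚ VE'] in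
/-- The components of the inverse symmetry morphism (by `rfl`). [cite: DeligneHodgeII1971, 1.1.12] -/
@[simp]
theorem lTensorToRTensor_left : (E.lTensorToRTensor C).left = tensorComm C B := rfl

omit [FiniteDimensional ℚ VA'] [FiniteDimensional ℚ VB'] [FiniteDimensional ℚ VE'] [AddCommGroup VA']
  [Module ℚ VA'] [AddCommGroup VB'] [Module ℚ VB'] [AddCommGroup VE'] [Module ℚ VE'] in
/-- The components of the inverse symmetry morphism (by `rfl`). [cite: DeligneHodgeII1971, 1.1.12] -/
@[simp]
theorem lTensorToRTensor_right : (E.lTensorToRTensor C).right = tensorComm C A := rfl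

end Extension

/-- `(σ_{A,C} ∘ σ_{C,A})^* = id` on `J⁰W₀Hom`. [cite: DeligneHodgeII1971, 1.1.12] -/
theorem JHomW.precomp_tensorComm_precomp_tensorComm {VB₀ : Type*} [AddCommGroup VB₀] [Module ℚ VB₀]
    (B₀ : MixedHodgeStructure VB₀) (A : MixedHodgeStructure VA) (C : MixedHodgeStructure VC)
    (c : JHomW (tensor C A) B₀) :
    JHomW.precomp B₀ (tensorComm C A) (JHomW.precomp B₀ (tensorComm A C) c) = c := by
  rw [← LinearMap.comp_apply, ← JHomW.precomp_comp, tensorComm_comp_tensorComm, JHomW.precomp_id,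
    LinearMap.id_apply]

/-- `(σ_{C,B})_* (σ_{B,C})_* = id` on `J⁰W₀Hom`. [cite: DeligneHodgeII1971, 1.1.12] -/
theorem JHomW.postcomp_tensorComm_postcomp_tensorComm {VA₀ : Type*} [AddCommGroup VA₀] [Module ℚ VA₀]
    (A₀ : MixedHodgeStructure VA₀) (B : MixedHodgeStructure VB) (C : MixedHodgeStructure VC)
    (c : JHomW A₀ (tensor B C)) :
    JHomW.postcomp A₀ (tensorComm C B) (JHomW.postcomp A₀ (tensorComm B C) c) = c := by
  rw [← LinearMap.comp_apply, ← JHomW.postcomp_comp, tensorComm_comp_tensorComm, JHomW.postcomp_id,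
    LinearMap.id_apply]

end Symmetry

/-! ### §2 The class of `C ⊗ E` -/

section ClassFormula

variable {A : MixedHodgeStructure VA} {B : MixedHodgeStructure VB}
variable {A' : MixedHodgeStructure VA'} {B' : MixedHodgeStructure VB'}

namespace Extension

variable (E : Extension A B VE) (C : MixedHodgeStructure VC)

omit [FiniteDimensional ℚ VA'] [FiniteDimensional ℚ VB'] [FiniteDimensional ℚ VE'] [AddCommGroup VA']
  [Module ℚ VA'] [AddCommGroup VB'] [Module ℚ VB'] [AddCommGroup VE'] [Module ℚ VE'] in
/-- Along the symmetry morphism: `(σ_{B,C})_* [E ⊗ C]_W = (σ_{A,C})^* [C ⊗ E]_W` (Mac Lane III Prop. 1.8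
in the complete invariant). [cite: MacLane1963Homology, Ch. III Prop. 1.8] -/
theorem postcomp_clsW_rTensor_eq_precomp_clsW_lTensor :
    JHomW.postcomp (tensor A C) (tensorComm B C) (E.rTensor C).clsW =
      JHomW.precomp (tensor C B) (tensorComm A C) (E.lTensor C).clsW :=
  (E.rTensorToLTensor C).postcomp_clsW_eq_precomp_clsW

omit [FiniteDimensional ℚ VA'] [FiniteDimensional ℚ VB'] [FiniteDimensional ℚ VE'] [AddCommGroup VA']
  [Module ℚ VA'] [AddCommGroup VB'] [Module ℚ VB'] [AddCommGroup VE'] [Module ℚ VE'] in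
/-- **`[C ⊗ E]_W = (σ_{C,A})^* (σ_{B,C})_* [E ⊗ C]_W`.** [cite: MacLane1963Homology, Ch. III Prop. 1.8] -/
theorem clsW_lTensor_eq_clsW_rTensor :
    (E.lTensor C).clsW =
      JHomW.precomp (tensor C B) (tensorComm C A)
        (JHomW.postcomp (tensor A C) (tensorComm B C) (E.rTensor C).clsW) := by
  rw [postcomp_clsW_rTensor_eq_precomp_clsW_lTensor, JHomW.precomp_tensorComm_precomp_tensorComm]

omit [FiniteDimensional ℚ VA'] [FiniteDimensional ℚ VB'] [FiniteDimensional ℚ VE'] [AddCommGroup VA']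
  [Module ℚ VA'] [AddCommGroup VB'] [Module ℚ VB'] [AddCommGroup VE'] [Module ℚ VE'] in
/-- **`[C ⊗ E]_W = (σ_{C,A})^* (σ_{B,C})_* ([E]_W ⊗ 1)`** — the class of the left tensor product from
the class formula for `E ⊗ C`. [cite: Jannsen1990MixedMotives, §9 Remark 9.3 a)] -/
theorem clsW_lTensor_eq :
    (E.lTensor C).clsW =
      JHomW.precomp (tensor C B) (tensorComm C A)
        (JHomW.postcomp (tensor A C) (tensorComm B C) (JHomW.rTensor VC C E.clsW)) := by
  rw [clsW_lTensor_eq_clsW_rTensor, clsW_rTensor]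

omit [FiniteDimensional ℚ VA'] [FiniteDimensional ℚ VB'] [FiniteDimensional ℚ VE'] [AddCommGroup VA']
  [Module ℚ VA'] [AddCommGroup VB'] [Module ℚ VB'] [AddCommGroup VE'] [Module ℚ VE'] in
/-- Conversely `[E ⊗ C]_W = (σ_{A,C})^* (σ_{C,B})_* [C ⊗ E]_W`. [cite: MacLane1963Homology, Ch. III Prop. 1.8] -/
theorem clsW_rTensor_eq_clsW_lTensor :
    (E.rTensor C).clsW =
      JHomW.precomp (tensor B C) (tensorComm A C)
        (JHomW.postcomp (tensor C A) (tensorComm C B) (E.lTensor C).clsW) := by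
  have h := (E.lTensorToRTensor C).postcomp_clsW_eq_precomp_clsW
  rw [lTensorToRTensor_left, lTensorToRTensor_right] at h
  rw [h, JHomW.precomp_tensorComm_precomp_tensorComm]

end Extension

variable (C : MixedHodgeStructure VC)

/-- **`1 ⊗ · : J⁰W₀Hom(A, B) → J⁰W₀Hom(C ⊗ A, C ⊗ B)`**, `[φ] ↦ [(σ_{B,C})_ℂ ∘ (φ ⊗ 1) ∘ (σ_{C,A})_ℂ]`
(`= [1 ⊗ φ]`): the symmetry-conjugate of `JHomW.rTensor`. [cite: Jannsen1990MixedMotives, §9 Remark 9.3 a)] -/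
def JHomW.lTensor : JHomW A B →ₗ[ℚ] JHomW (tensor C A) (tensor C B) :=
  JHomW.precomp (tensor C B) (tensorComm C A) ∘ₗ JHomW.postcomp (tensor A C) (tensorComm B C) ∘ₗ
    JHomW.rTensor VC C

omit [FiniteDimensional ℚ VA'] [FiniteDimensional ℚ VB'] [AddCommGroup VA'] [Module ℚ VA'] [AddCommGroup VB']
  [Module ℚ VB'] in
/-- Unfolding `JHomW.lTensor` (by `rfl`). [cite: Jannsen1990MixedMotives, §9 Remark 9.3 a)] -/
theorem JHomW.lTensor_apply (c : JHomW A B) :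
    JHomW.lTensor C c =
      JHomW.precomp (tensor C B) (tensorComm C A) (JHomW.postcomp (tensor A C) (tensorComm B C)
        (JHomW.rTensor VC C c)) :=
  rfl

omit [FiniteDimensional ℚ VA'] [FiniteDimensional ℚ VB'] [AddCommGroup VA'] [Module ℚ VA'] [AddCommGroup VB']
  [Module ℚ VB'] in
/-- `(1 ⊗ ·) [φ] = [(σ_{B,C})_ℂ ∘ (φ ⊗ 1) ∘ (σ_{C,A})_ℂ]`. [cite: Jannsen1990MixedMotives, §9 Remark 9.3 a)] -/
theorem JHomW.lTensor_mk (φ : ↥((homW A B).restrictScalars ℚ)) :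
    JHomW.lTensor C (JHomW.mk A B φ) =
      JHomW.mk (tensor C A) (tensor C B)
        ⟨((tensorComm B C).toLinearMap.baseChange ℂ ∘ₗ rTensorC VC (φ : _ →ₗ[ℂ] _)) ∘ₗ
          (tensorComm C A).toLinearMap.baseChange ℂ,
          mem_homW_comp (tensorComm C A) (comp_mem_homW (tensorComm B C) (rTensorC_mem_homW VC C φ.2))⟩ :=
  rfl

omit [FiniteDimensional ℚ VA'] [FiniteDimensional ℚ VB'] [AddCommGroup VA'] [Module ℚ VA'] [AddCommGroup VB']
  [Module ℚ VB'] in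
/-- `⊗ 1` recovered from `1 ⊗ ·` by the symmetry: `[φ] ⊗ 1 = (σ_{A,C})^* (σ_{C,B})_* (1 ⊗ [φ])`.
[cite: DeligneHodgeII1971, 1.1.12] -/
theorem JHomW.rTensor_eq_precomp_postcomp_lTensor (c : JHomW A B) :
    JHomW.rTensor VC C c =
      JHomW.precomp (tensor B C) (tensorComm A C) (JHomW.postcomp (tensor C A) (tensorComm C B)
        (JHomW.lTensor C c)) := by
  rw [JHomW.lTensor_apply, ← LinearMap.comp_apply (JHomW.postcomp (tensor C A) (tensorComm C B)),
    ← JHomW.precomp_comp_postcomp, LinearMap.comp_apply, JHomW.postcomp_tensorComm_postcomp_tensorComm,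
    JHomW.precomp_tensorComm_precomp_tensorComm]

namespace Extension

variable (E : Extension A B VE)

omit [FiniteDimensional ℚ VA'] [FiniteDimensional ℚ VB'] [FiniteDimensional ℚ VE'] [AddCommGroup VA']
  [Module ℚ VA'] [AddCommGroup VB'] [Module ℚ VB'] [AddCommGroup VE'] [Module ℚ VE'] in
/-- **The class formula `[C ⊗ E]_W = 1 ⊗ [E]_W` in `J⁰W₀Hom(C ⊗ A, C ⊗ B)`**, for ALL `A`, `B`, `C`.
[cite: Jannsen1990MixedMotives, §9 Remark 9.3 a)] -/
theorem clsW_lTensor : (E.lTensor C).clsW = JHomW.lTensor C E.clsW :=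
  E.clsW_lTensor_eq C

omit [FiniteDimensional ℚ VA'] [FiniteDimensional ℚ VB'] [FiniteDimensional ℚ VE'] [AddCommGroup VA']
  [Module ℚ VA'] [AddCommGroup VB'] [Module ℚ VB'] [AddCommGroup VE'] [Module ℚ VE'] in
/-- `C ⊗ E` splits iff `1 ⊗ [E]_W = 0`. [cite: BrylinskiZucker1998, Prop. 5.22] -/
theorem isSplit_lTensor_iff : (E.lTensor C).IsSplit ↔ JHomW.lTensor C E.clsW = 0 := by
  rw [isSplit_iff_clsW_eq_zero, clsW_lTensor]

omit [FiniteDimensional ℚ VA'] [FiniteDimensional ℚ VB'] [FiniteDimensional ℚ VE'] [AddCommGroup VA']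
  [Module ℚ VA'] [AddCommGroup VB'] [Module ℚ VB'] [AddCommGroup VE'] [Module ℚ VE'] in
/-- **`C ⊗ E` splits iff `E ⊗ C` splits.** [cite: MacLane1963Homology, Ch. III Prop. 1.8] -/
theorem isSplit_lTensor_iff_isSplit_rTensor : (E.lTensor C).IsSplit ↔ (E.rTensor C).IsSplit := by
  rw [isSplit_iff_clsW_eq_zero, isSplit_iff_clsW_eq_zero]
  constructor
  · intro h
    rw [clsW_rTensor_eq_clsW_lTensor, h, map_zero, map_zero]
  · intro h
    rw [clsW_lTensor_eq_clsW_rTensor, h, map_zero, map_zero]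

omit [FiniteDimensional ℚ VA'] [FiniteDimensional ℚ VB'] [AddCommGroup VA'] [Module ℚ VA'] [AddCommGroup VB']
  [Module ℚ VB'] in
/-- **Extensions with the same refined class have congruent left tensor products** (`C ⊗ ·` is well
defined on congruence classes). [cite: BrylinskiZucker1998, Prop. 5.22] -/
theorem nonempty_congruence_lTensor_of_clsW_eq {E' : Extension A B VE'} (h : E.clsW = E'.clsW) :
    Nonempty (Congruence (E.lTensor C) (E'.lTensor C)) := by
  rw [nonempty_congruence_iff_clsW_eq, clsW_lTensor, clsW_lTensor, h]

omit [FiniteDimensional ℚ VA'] [FiniteDimensional ℚ VB'] [AddCommGroup VA'] [Module ℚ VA'] [AddCommGroup VB']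
  [Module ℚ VB'] in
/-- **Congruent extensions stay congruent after `C ⊗`.** [cite: MacLane1963Homology, Ch. III §1] -/
theorem nonempty_congruence_lTensor {E' : Extension A B VE'} (h : Nonempty (Congruence E E')) :
    Nonempty (Congruence (E.lTensor C) (E'.lTensor C)) :=
  E.nonempty_congruence_lTensor_of_clsW_eq C ((nonempty_congruence_iff_clsW_eq E E').1 h)

end Extension

end ClassFormula

/-! ### §3 `C ⊗ · : Ext(A, B) → Ext(C ⊗ A, C ⊗ B)` -/

namespace Ext

variable {A : MixedHodgeStructure VA} {B : MixedHodgeStructure VB}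
variable {A' : MixedHodgeStructure VA'} {B' : MixedHodgeStructure VB'}
variable (C : MixedHodgeStructure VC)

omit [FiniteDimensional ℚ VA'] [FiniteDimensional ℚ VB'] [FiniteDimensional ℚ VE] [FiniteDimensional ℚ VE']
  [AddCommGroup VA'] [Module ℚ VA'] [AddCommGroup VB'] [Module ℚ VB'] [AddCommGroup VE] [Module ℚ VE]
  [AddCommGroup VE'] [Module ℚ VE'] in
/-- **`C ⊗ · : Ext(A, B) → Ext(C ⊗ A, C ⊗ B)`, `x ↦ (σ_{C,A})^* (σ_{B,C})_* (x ⊗ C)`** — on classes of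
extensions it is `[E] ↦ [C ⊗ E]` (`lTensorMap_mkOfW`). [cite: Jannsen1990MixedMotives, §9 Remark 9.3 a)] -/
def lTensorMap (x : Ext A B) : Ext (tensor C A) (tensor C B) :=
  pullbackMapW (tensorComm C A) (pushoutMapW (tensorComm B C) (rTensorMap C x))

omit [FiniteDimensional ℚ VA'] [FiniteDimensional ℚ VB'] [FiniteDimensional ℚ VE] [FiniteDimensional ℚ VE']
  [AddCommGroup VA'] [Module ℚ VA'] [AddCommGroup VB'] [Module ℚ VB'] [AddCommGroup VE] [Module ℚ VE]
  [AddCommGroup VE'] [Module ℚ VE'] in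
/-- Unfolding `lTensorMap` (by `rfl`). [cite: Jannsen1990MixedMotives, §9 Remark 9.3 a)] -/
theorem lTensorMap_def (x : Ext A B) :
    lTensorMap C x = pullbackMapW (tensorComm C A) (pushoutMapW (tensorComm B C) (rTensorMap C x)) :=
  rfl

omit [FiniteDimensional ℚ VA'] [FiniteDimensional ℚ VB'] [FiniteDimensional ℚ VE] [FiniteDimensional ℚ VE']
  [AddCommGroup VA'] [Module ℚ VA'] [AddCommGroup VB'] [Module ℚ VB'] [AddCommGroup VE] [Module ℚ VE]
  [AddCommGroup VE'] [Module ℚ VE'] in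
/-- `extEquivJHomW (C ⊗ x) = 1 ⊗ extEquivJHomW x`. [cite: BrylinskiZucker1998, Prop. 5.22] -/
@[simp]
theorem extEquivJHomW_lTensorMap (x : Ext A B) :
    extEquivJHomW (lTensorMap C x) = JHomW.lTensor C (extEquivJHomW x) := by
  rw [lTensorMap_def, extEquivJHomW_pullbackMapW, ← extEquivJHomW_apply, extEquivJHomW_pushoutMapW,
    ← extEquivJHomW_apply, extEquivJHomW_rTensorMap]
  rfl

omit [FiniteDimensional ℚ VA'] [FiniteDimensional ℚ VB'] [FiniteDimensional ℚ VE] [FiniteDimensional ℚ VE']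
  [AddCommGroup VA'] [Module ℚ VA'] [AddCommGroup VB'] [Module ℚ VB'] [AddCommGroup VE] [Module ℚ VE]
  [AddCommGroup VE'] [Module ℚ VE'] in
/-- `clsW (C ⊗ x) = 1 ⊗ clsW x`. [cite: BrylinskiZucker1998, Prop. 5.22] -/
theorem clsW_lTensorMap (x : Ext A B) : clsW (lTensorMap C x) = JHomW.lTensor C (clsW x) :=
  extEquivJHomW_lTensorMap C x

omit [FiniteDimensional ℚ VA'] [FiniteDimensional ℚ VB'] [FiniteDimensional ℚ VE'] [AddCommGroup VA']
  [Module ℚ VA'] [AddCommGroup VB'] [Module ℚ VB'] [AddCommGroup VE'] [Module ℚ VE'] in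
/-- **`C ⊗ [E] = [C ⊗ E]`** for an extension on any (finite-dimensional) carrier.
[cite: Jannsen1990MixedMotives, §9 Remark 9.3 a)] -/
theorem lTensorMap_mkOfW (E : Extension A B VE) : lTensorMap C (mkOfW E) = mkOfW (E.lTensor C) :=
  extEquivJHomW.injective (by
    rw [extEquivJHomW_lTensorMap, extEquivJHomW_apply, extEquivJHomW_apply, clsW_mkOfW, clsW_mkOfW,
      Extension.clsW_lTensor])

omit [FiniteDimensional ℚ VA'] [FiniteDimensional ℚ VB'] [FiniteDimensional ℚ VE] [FiniteDimensional ℚ VE']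
  [AddCommGroup VA'] [Module ℚ VA'] [AddCommGroup VB'] [Module ℚ VB'] [AddCommGroup VE] [Module ℚ VE]
  [AddCommGroup VE'] [Module ℚ VE'] in
/-- `C ⊗ (mk E) = [C ⊗ E]`. [cite: Jannsen1990MixedMotives, §9 Remark 9.3 a)] -/
theorem lTensorMap_mk (E : Extension A B (VA × VB)) : lTensorMap C (mk E) = mkOfW (E.lTensor C) := by
  rw [← mkOfW_eq_mk, lTensorMap_mkOfW]

omit [FiniteDimensional ℚ VA'] [FiniteDimensional ℚ VB'] [FiniteDimensional ℚ VE] [FiniteDimensional ℚ VE']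
  [AddCommGroup VA'] [Module ℚ VA'] [AddCommGroup VB'] [Module ℚ VB'] [AddCommGroup VE] [Module ℚ VE]
  [AddCommGroup VE'] [Module ℚ VE'] in
/-- **`C ⊗ ·` is additive for the Baer sum** (all pairs `A`, `B`). [cite: Jannsen1990MixedMotives, §9 Remark 9.3 a)] -/
theorem lTensorMap_addW (x y : Ext A B) :
    lTensorMap C (addW x y) = addW (lTensorMap C x) (lTensorMap C y) :=
  extEquivJHomW.injective (by
    rw [extEquivJHomW_lTensorMap, extEquivJHomW_addW, extEquivJHomW_addW, map_add,
      extEquivJHomW_lTensorMap, extEquivJHomW_lTensorMap])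

omit [FiniteDimensional ℚ VA'] [FiniteDimensional ℚ VB'] [FiniteDimensional ℚ VE] [FiniteDimensional ℚ VE']
  [AddCommGroup VA'] [Module ℚ VA'] [AddCommGroup VB'] [Module ℚ VB'] [AddCommGroup VE] [Module ℚ VE]
  [AddCommGroup VE'] [Module ℚ VE'] in
/-- `C ⊗ 0 = 0`: the split class goes to the split class. [cite: MacLane1963Homology, Ch. III §1] -/
theorem lTensorMap_zeroW : lTensorMap C (zeroW : Ext A B) = zeroW :=
  extEquivJHomW.injective (by
    rw [extEquivJHomW_lTensorMap, extEquivJHomW_zeroW, extEquivJHomW_zeroW, map_zero])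

omit [FiniteDimensional ℚ VA'] [FiniteDimensional ℚ VB'] [FiniteDimensional ℚ VE] [FiniteDimensional ℚ VE']
  [AddCommGroup VA'] [Module ℚ VA'] [AddCommGroup VB'] [Module ℚ VB'] [AddCommGroup VE] [Module ℚ VE]
  [AddCommGroup VE'] [Module ℚ VE'] in
/-- `C ⊗ (-x) = -(C ⊗ x)`. [cite: Jannsen1990MixedMotives, §9 Remark 9.3 a)] -/
theorem lTensorMap_negW (x : Ext A B) : lTensorMap C (negW x) = negW (lTensorMap C x) :=
  extEquivJHomW.injective (by
    rw [extEquivJHomW_lTensorMap, extEquivJHomW_negW, extEquivJHomW_negW, map_neg, extEquivJHomW_lTensorMap])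

omit [FiniteDimensional ℚ VA'] [FiniteDimensional ℚ VB'] [FiniteDimensional ℚ VE] [FiniteDimensional ℚ VE']
  [AddCommGroup VA'] [Module ℚ VA'] [AddCommGroup VB'] [Module ℚ VB'] [AddCommGroup VE] [Module ℚ VE]
  [AddCommGroup VE'] [Module ℚ VE'] in
/-- **The symmetry square on `Ext`**: `x ⊗ C = (σ_{A,C})^* (σ_{C,B})_* (C ⊗ x)`.
[cite: DeligneHodgeII1971, 1.1.12] -/
theorem rTensorMap_eq_pullbackMapW_pushoutMapW_lTensorMap (x : Ext A B) :
    rTensorMap C x = pullbackMapW (tensorComm A C) (pushoutMapW (tensorComm C B) (lTensorMap C x)) :=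
  extEquivJHomW.injective (by
    rw [extEquivJHomW_rTensorMap, extEquivJHomW_pullbackMapW, ← extEquivJHomW_apply,
      extEquivJHomW_pushoutMapW, ← extEquivJHomW_apply, extEquivJHomW_lTensorMap]
    exact JHomW.rTensor_eq_precomp_postcomp_lTensor C _)

omit [FiniteDimensional ℚ VA'] [FiniteDimensional ℚ VB'] [FiniteDimensional ℚ VE] [FiniteDimensional ℚ VE']
  [AddCommGroup VA'] [Module ℚ VA'] [AddCommGroup VB'] [Module ℚ VB'] [AddCommGroup VE] [Module ℚ VE]
  [AddCommGroup VE'] [Module ℚ VE'] in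
/-- `C ⊗ x` is the split class iff `x ⊗ C` is. [cite: MacLane1963Homology, Ch. III Prop. 1.8] -/
theorem lTensorMap_eq_zeroW_iff (x : Ext A B) : lTensorMap C x = zeroW ↔ rTensorMap C x = zeroW := by
  obtain ⟨E, rfl⟩ := exists_mkOfW_eq x
  rw [lTensorMap_mkOfW, rTensorMap_mkOfW, mkOfW_eq_zeroW_iff, mkOfW_eq_zeroW_iff,
    Extension.isSplit_lTensor_iff_isSplit_rTensor]

omit [FiniteDimensional ℚ VA'] [FiniteDimensional ℚ VE] [FiniteDimensional ℚ VE'] [AddCommGroup VA']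
  [Module ℚ VA'] [AddCommGroup VE] [Module ℚ VE] [AddCommGroup VE'] [Module ℚ VE'] in
/-- **Naturality in the sub: `C ⊗ (g_* x) = (1 ⊗ g)_* (C ⊗ x)`.** [cite: MacLane1963Homology, Ch. III Lemma 1.4] -/
theorem lTensorMap_pushoutMapW (g : Hom B B') (x : Ext A B) :
    lTensorMap C (pushoutMapW g x) = pushoutMapW ((Hom.id C).tensorMap g) (lTensorMap C x) := by
  rw [lTensorMap_def, lTensorMap_def, rTensorMap_pushoutMapW, ← pushoutMapW_comp, tensorComm_comp_tensorMap_id,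
    pushoutMapW_comp, pushoutMapW_pullbackMapW]

omit [FiniteDimensional ℚ VB'] [FiniteDimensional ℚ VE] [FiniteDimensional ℚ VE'] [AddCommGroup VB']
  [Module ℚ VB'] [AddCommGroup VE] [Module ℚ VE] [AddCommGroup VE'] [Module ℚ VE'] in
/-- **Naturality in the quotient: `C ⊗ (f^* x) = (1 ⊗ f)^* (C ⊗ x)`.** [cite: MacLane1963Homology, Ch. III Lemma 1.2] -/
theorem lTensorMap_pullbackMapW (f : Hom A' A) (x : Ext A B) :
    lTensorMap C (pullbackMapW f x) = pullbackMapW ((Hom.id C).tensorMap f) (lTensorMap C x) := by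
  rw [lTensorMap_def, lTensorMap_def, rTensorMap_pullbackMapW, ← pushoutMapW_pullbackMapW, ← pullbackMapW_comp,
    ← pullbackMapW_comp, ← tensorComm_comp_id_tensorMap, pushoutMapW_pullbackMapW]

end Ext

end MixedHodgeStructure

end Literature.AlgebraicGeometry.Motives

end
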